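import Mathlib.LinearAlgebra.Eigenspace.Triangularizable
import Mathlib.Analysis.Complex.Polynomial.Basic
import Literature.Computability.AlgebraicComplexity.LRPencilOfMatrix
import HarnessLib

/-!
# Landsberg–Ressayre — the character of an exact lift: `det g · γ₀ = det h · β_top`
  (LR17 Lemma 3.1 with Lemma 3.3), and the top weight of a torus lift of `perm_m`

Topic `Literature/Computability/AlgebraicComplexity`.  A piece of the bottom-up proof of the named
fact `lr_full_equivariant_lower` (`LandsbergRessayre.lean`; LR17 Thm. 2.1, lower bound), usable by
any assembly built on the pencil files `LRCanonicalSubspaces` / `LRTorusWeights` / `LRWeightCount` /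
`LR21CanonicalSubspaces`: the identification of the TOP WEIGHT of a torus lift.

For an exact lift `(g, h)` of a symmetry (`g Λ = Λ h`, LR17 Def. 1.2/1.3) of a REGULAR pencil
(`rank Λ = n - 1`), `h` acts on the kernel line `ker Λ = ℓ_1` by a scalar `γ₀` and `g` acts on the
cokernel line `ℂⁿ / range Λ = ℓ_2` by a scalar `β_top` (all weight spaces `E β` of `g` with
`β ≠ β_top` lie in `range Λ`, cf. `TorusData.exists_top`).  LR17 Lemma 3.3 writes the pair in the
normal form `Λ = Λ_{n-1}` as `g = [[lam, 0], [v₂, G]]`, `h = [[λ₁, φ₁], [0, G]]` with the SAME block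
`G`, so that the character of `𝔾_{det_n}` takes the value `χ_{det_n}(g, h) = det g / det h = lam / λ₁`
(LR17 Lemma 3.1: `χ_{det_n} = χ_P ∘ ρ̄_A` on `𝔾_A`).  In the elementary language of the tree:

* `det_mul_apply_eq_of_mul_lamMatrix`: in the normal form, `det g · h_{i₀i₀} = det h · g_{i₀i₀}`;
* `det_mul_eq_det_mul_top`: for any regular `Λ` and `g Λ = Λ h`:  `det g · γ₀ = det h · β_top`,
  where `γ₀`, `β_top` are characterised exactly as in `LRPencilOfMatrix.exists_eigenvalue_of_finrank_ker_eq_one`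
  (`ker Λ ⊆ F γ₀`) and `LRWeightCount` (`TorusData.exists_top`: `β ≠ β_top ⇒ E β ⊆ range Λ`);
* `linSubst_diagonal_perPoly`: the torus `diag(d) ⊗ diag(e)` rescales the permanent by its character
  `∏ d · ∏ e` (LR17 §1: `χ_{perm_m}` on `T(E) × T(F)`), and `det_mul_det_inv_eq_of_linSubstEntries_eq`:
  an exact lift `(g, h)` of `γ` of a representation of `f` has `γ · f = (det g · det h⁻¹) f`
  (LR17 Lemma 3.1), whence `det g = (∏ d ∏ e) · det h` for a torus lift of `perm_m`;
* `top_eq_character_mul`: consequently the top weight of a torus lift of an affine determinantal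
  representation of `perm_m` is `β_top = (∏ d · ∏ e) · γ₀` — the exponent of the top weight is
  `(1, …, 1; 1, …, 1)` (LR17 §6: "the action of `γ` shows that `α = k - 1`", i.e. the character of `ℓ_2`
  is pinned; in the two-sided count this is what forces the chain to pass through support sizes
  `(s, s)` for every `s`).

Everything is proved; no named facts.  Appended (`TopExists`): the abstract existence of the
top weight (`exists_top_of_map_range_le`, the content of `TorusData.exists_top` for any `B`
preserving `range Λ`) and the unconditional form `maxGenEigenspace_le_range_of_ne_character`:
for a torus lift of `perm_m`, every weight `β ≠ (∏ d ∏ e) γ₀` of `g` lies in `range Λ`.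

## References

* J. M. Landsberg, N. Ressayre, *Permanent v. determinant: an exponential lower bound assuming
  symmetry and a potential path towards Valiant's conjecture*, Differential Geom. Appl. 55 (2017)
  146–166, arXiv:1508.05788: Lemma 3.1, Lemma 3.3, §3.3, §6.
-/

noncomputable section

namespace Literature.Computability.AlgebraicComplexity

namespace LRPencil

open _root_.Matrix MvPolynomial Finset Module.End
open scoped Kronecker

/-! ### LR17 Lemma 3.3 ⇒ the determinant identity in the normal form -/

section NormalFormDet

variable {K : Type*} [CommRing K] {n : ℕ}

/-- In the normal form `Λ = Λ_{i₀}`: if `g Λ_{i₀} = Λ_{i₀} h` then `det g · h_{i₀i₀} = det h · g_{i₀i₀}`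
(LR17 Lemma 3.3: `g = [[lam, 0], [v₂, G]]`, `h = [[λ₁, φ₁], [0, G]]` with the same `G`, so
`det g = lam det G`, `det h = λ₁ det G`; Laplace expansion along the `i₀`-row of `g` and the
`i₀`-column of `h`). [cite: LandsbergRessayre2017, Lemma 3.3] -/
theorem det_mul_apply_eq_of_mul_lamMatrix {i₀ : Fin (n + 1)}
    {g h : Matrix (Fin (n + 1)) (Fin (n + 1)) K} (e : g * lamMatrix K i₀ = lamMatrix K i₀ * h) :
    g.det * h i₀ i₀ = h.det * g i₀ i₀ := by
  obtain ⟨hrow, hcol, heq⟩ := (mul_lamMatrix_eq_lamMatrix_mul_iff i₀ g h).1 e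
  have hsub : g.submatrix i₀.succAbove i₀.succAbove = h.submatrix i₀.succAbove i₀.succAbove := by
    ext a b
    exact heq _ _ (Fin.succAbove_ne i₀ a) (Fin.succAbove_ne i₀ b)
  have hsign : ((-1 : K) ^ ((i₀ : ℕ) + (i₀ : ℕ))) = 1 := by
    rw [← two_mul, pow_mul, neg_one_sq, one_pow]
  have hg : g.det = g i₀ i₀ * (g.submatrix i₀.succAbove i₀.succAbove).det := by
    rw [Matrix.det_succ_row g i₀, Finset.sum_eq_single i₀]
    · rw [hsign, one_mul]
    · intro j _ hj
      rw [hrow j hj, mul_zero, zero_mul]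
    · intro hi; exact absurd (Finset.mem_univ i₀) hi
  have hh : h.det = h i₀ i₀ * (h.submatrix i₀.succAbove i₀.succAbove).det := by
    rw [Matrix.det_succ_column h i₀, Finset.sum_eq_single i₀]
    · rw [hsign, one_mul]
    · intro i _ hi
      rw [hcol i hi, mul_zero, zero_mul]
    · intro hi; exact absurd (Finset.mem_univ i₀) hi
  rw [hg, hh, hsub]
  ring

end NormalFormDet

/-! ### The character identity `det g · γ₀ = det h · β_top` for a regular pencil -/

section Character

variable {n : ℕ}

/-- A functional `φ` with `φ ∘ B = lam φ` satisfies `φ ∘ (B - β)^k = (lam - β)^k φ`. [folklore] -/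
theorem apply_pow_sub_smul_eq {V : Type*} [AddCommGroup V] [Module ℂ V] (B : Module.End ℂ V)
    (φ : V →ₗ[ℂ] ℂ) {lam : ℂ} (hφ : ∀ v, φ (B v) = lam * φ v) (β : ℂ) (k : ℕ) (v : V) :
    φ (((B - β • (1 : Module.End ℂ V)) ^ k) v) = (lam - β) ^ k * φ v := by
  induction k generalizing v with
  | zero => simp
  | succ k ih =>
    rw [pow_succ, Module.End.mul_apply, ih, pow_succ]
    simp only [LinearMap.sub_apply, LinearMap.smul_apply, Module.End.one_apply, map_sub, map_smul,
      smul_eq_mul, hφ]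
    ring

/-- **The character of an exact lift** (LR17 Lemma 3.1 with Lemma 3.3, elementary form): let `Λ`
be an `n × n` matrix of rank `n - 1` (`n ≥ 1`) and `g Λ = Λ h`.  If `h` has the generalised
eigenvalue `γ₀` on the kernel line (`ker Λ ⊆ F γ₀`) and `β_top` is the weight of `g` on the
cokernel line (every weight space `E β` of `g` with `β ≠ β_top` lies in `range Λ`), then
`det g · γ₀ = det h · β_top`.  (In the normal form `Λ_{n-1}`, `γ₀ = λ₁`, `β_top = lam` and
`det g / det h = lam det G / (λ₁ det G)`.) [cite: LandsbergRessayre2017, Lemma 3.3] -/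
theorem det_mul_eq_det_mul_top (hn : 0 < n) {Λm : Matrix (Fin n) (Fin n) ℂ} (hΛ : Λm.rank = n - 1)
    {g h : Matrix (Fin n) (Fin n) ℂ} (e : g * Λm = Λm * h) {γ₀ βt : ℂ}
    (hγ : LinearMap.ker (Matrix.toLin' Λm) ≤ maxGenEigenspace (Matrix.toLin' h) γ₀)
    (hβ : ∀ β, β ≠ βt → maxGenEigenspace (Matrix.toLin' g) β ≤ LinearMap.range (Matrix.toLin' Λm)) :
    g.det * γ₀ = h.det * βt := by
  classical
  obtain ⟨n', rfl⟩ : ∃ n', n = n' + 1 := ⟨n - 1, by omega⟩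
  obtain ⟨V₀, U₀, i₀, hV₀, hU₀, hnf⟩ :=
    exists_mul_mul_eq_lamMatrix Λm (by rw [hΛ, Fintype.card_fin]) (by rw [Fintype.card_fin]; exact hn)
  have hV₀d : IsUnit V₀.det := (Matrix.isUnit_iff_isUnit_det _).1 hV₀
  have hU₀d : IsUnit U₀.det := (Matrix.isUnit_iff_isUnit_det _).1 hU₀
  have hVinv : V₀⁻¹ * V₀ = 1 := Matrix.nonsing_inv_mul V₀ hV₀d
  have hVinv' : V₀ * V₀⁻¹ = 1 := Matrix.mul_nonsing_inv V₀ hV₀d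
  have hUinv : U₀⁻¹ * U₀ = 1 := Matrix.nonsing_inv_mul U₀ hU₀d
  have hUinv' : U₀ * U₀⁻¹ = 1 := Matrix.mul_nonsing_inv U₀ hU₀d
  set Λ₀ : Matrix (Fin (n' + 1)) (Fin (n' + 1)) ℂ := lamMatrix ℂ i₀ with hΛ₀
  -- `Λ = V₀⁻¹ Λ₀ U₀⁻¹`
  have hΛeq : Λm = V₀⁻¹ * Λ₀ * U₀⁻¹ := by
    rw [← hnf]
    calc Λm = (V₀⁻¹ * V₀) * Λm * (U₀ * U₀⁻¹) := by rw [hVinv, hUinv', Matrix.one_mul, Matrix.mul_one]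
      _ = V₀⁻¹ * (V₀ * Λm * U₀) * U₀⁻¹ := by simp only [Matrix.mul_assoc]
  set g' := V₀ * g * V₀⁻¹ with hg'
  set h' := U₀⁻¹ * h * U₀ with hh'
  have e' : g' * Λ₀ = Λ₀ * h' := by
    rw [hg', hh', ← hnf]
    calc V₀ * g * V₀⁻¹ * (V₀ * Λm * U₀) = V₀ * g * (V₀⁻¹ * V₀) * Λm * U₀ := by
          simp only [Matrix.mul_assoc]
      _ = V₀ * (g * Λm) * U₀ := by rw [hVinv, Matrix.mul_one]; simp only [Matrix.mul_assoc]
      _ = V₀ * (Λm * h) * U₀ := by rw [e]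
      _ = V₀ * Λm * (U₀ * U₀⁻¹) * h * U₀ := by
          rw [hUinv', Matrix.mul_one]; simp only [Matrix.mul_assoc]
      _ = V₀ * Λm * U₀ * (U₀⁻¹ * h * U₀) := by simp only [Matrix.mul_assoc]
  have hdet' := det_mul_apply_eq_of_mul_lamMatrix e'
  have hdg : g'.det = g.det := by rw [hg']; exact Matrix.det_conj hV₀ g
  have hdh : h'.det = h.det := by rw [hh']; exact Matrix.det_conj' hU₀ h
  obtain ⟨hrow, hcol, -⟩ := (mul_lamMatrix_eq_lamMatrix_mul_iff i₀ g' h').1 e'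
  -- `Λ₀` kills exactly the `i₀`-coordinate
  have hΛ₀v : ∀ x : Fin (n' + 1) → ℂ, ∀ i, (Λ₀ *ᵥ x) i = if i = i₀ then 0 else x i := by
    intro x i
    rw [hΛ₀, lamMatrix, Matrix.mulVec_diagonal]
    split_ifs <;> simp
  ------------------------------------------------------------------
  -- Step 1: `γ₀ = h'_{i₀ i₀}` (the weight of `h` on the kernel line)
  ------------------------------------------------------------------
  have hγ₀ : γ₀ = h' i₀ i₀ := by
    set u : Fin (n' + 1) → ℂ := U₀ *ᵥ Pi.single i₀ 1 with hu
    have hu0 : u ≠ 0 := by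
      intro h0
      have h1 : U₀⁻¹ *ᵥ u = Pi.single i₀ 1 := by
        rw [hu, Matrix.mulVec_mulVec, hUinv, Matrix.one_mulVec]
      rw [h0, Matrix.mulVec_zero] at h1
      have := congrFun h1 i₀
      simp at this
    have huker : u ∈ LinearMap.ker (Matrix.toLin' Λm) := by
      rw [LinearMap.mem_ker, Matrix.toLin'_apply, hΛeq, hu, Matrix.mulVec_mulVec, Matrix.mul_assoc,
        hUinv, Matrix.mul_one, ← Matrix.mulVec_mulVec]
      have : Λ₀ *ᵥ Pi.single i₀ (1 : ℂ) = 0 := by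
        funext i
        rw [hΛ₀v]
        split_ifs with hi
        · rfl
        · simp [hi]
      rw [this, Matrix.mulVec_zero]
    -- `h u = h'_{i₀i₀} u`
    have hcolh' : h' *ᵥ Pi.single i₀ (1 : ℂ) = h' i₀ i₀ • Pi.single i₀ (1 : ℂ) := by
      funext i
      rw [Matrix.mulVec_single_one, Pi.smul_apply, smul_eq_mul]
      by_cases hi : i = i₀
      · subst hi; simp
      · rw [Matrix.col_apply, hcol i hi]; simp [hi]
    have hhu : Matrix.toLin' h u = h' i₀ i₀ • u := by
      rw [Matrix.toLin'_apply, hu, Matrix.mulVec_mulVec]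
      have hhU : h * U₀ = U₀ * h' := by
        rw [hh', ← Matrix.mul_assoc, ← Matrix.mul_assoc, hUinv', Matrix.one_mul]
      rw [hhU, ← Matrix.mulVec_mulVec, hcolh', Matrix.mulVec_smul]
    have hueig : u ∈ maxGenEigenspace (Matrix.toLin' h) (h' i₀ i₀) :=
      eigenspace_le_maxGenEigenspace (mem_eigenspace_iff.2 hhu)
    by_contra hne
    have hdis := Module.End.disjoint_genEigenspace (Matrix.toLin' h) hne ⊤ ⊤
    exact hu0 ((hdis.le_bot ⟨hγ huker, hueig⟩ : u ∈ (⊥ : Submodule ℂ _)))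
  ------------------------------------------------------------------
  -- Step 2: `βt = g'_{i₀ i₀}` (the weight of `g` on the cokernel line)
  ------------------------------------------------------------------
  -- the functional `φ v = (V₀ v)_{i₀}` with `ker φ = range Λ` and `φ ∘ g = g'_{i₀i₀} φ`
  let φ : (Fin (n' + 1) → ℂ) →ₗ[ℂ] ℂ := (LinearMap.proj i₀).comp (Matrix.toLin' V₀)
  have hφ : ∀ v, φ v = (V₀ *ᵥ v) i₀ := fun v => rfl
  have hφg : ∀ v, φ (Matrix.toLin' g v) = g' i₀ i₀ * φ v := by
    intro v
    rw [hφ, hφ, Matrix.toLin'_apply, Matrix.mulVec_mulVec]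
    have hVg : V₀ * g = g' * V₀ := by
      rw [hg', Matrix.mul_assoc, hVinv, Matrix.mul_one]
    rw [hVg, ← Matrix.mulVec_mulVec, Matrix.mulVec, dotProduct, Finset.sum_eq_single i₀]
    · intro j _ hj; rw [hrow j hj, zero_mul]
    · intro hi; exact absurd (Finset.mem_univ i₀) hi
  have hrange_le : LinearMap.range (Matrix.toLin' Λm) ≤ LinearMap.ker φ := by
    rintro _ ⟨w, rfl⟩
    have hVΛ : V₀ * (V₀⁻¹ * Λ₀ * U₀⁻¹) = Λ₀ * U₀⁻¹ := by
      rw [← Matrix.mul_assoc, ← Matrix.mul_assoc, hVinv', Matrix.one_mul]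
    rw [LinearMap.mem_ker, hφ, Matrix.toLin'_apply, hΛeq, Matrix.mulVec_mulVec, hVΛ,
      ← Matrix.mulVec_mulVec, hΛ₀v, if_pos rfl]
  have hker_le : LinearMap.ker φ ≤ LinearMap.range (Matrix.toLin' Λm) := by
    intro v hv
    rw [LinearMap.mem_ker, hφ] at hv
    refine ⟨U₀ *ᵥ (V₀ *ᵥ v), ?_⟩
    rw [Matrix.toLin'_apply, hΛeq, Matrix.mulVec_mulVec, Matrix.mul_assoc, hUinv, Matrix.mul_one,
      ← Matrix.mulVec_mulVec]
    have hfix : Λ₀ *ᵥ (V₀ *ᵥ v) = V₀ *ᵥ v := by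
      funext i
      rw [hΛ₀v]
      split_ifs with hi
      · rw [hi, hv]
      · rfl
    rw [hfix, Matrix.mulVec_mulVec, hVinv, Matrix.one_mulVec]
  have hE : ∀ β, β ≠ g' i₀ i₀ →
      maxGenEigenspace (Matrix.toLin' g) β ≤ LinearMap.range (Matrix.toLin' Λm) := by
    intro β hβne v hv
    apply hker_le
    obtain ⟨k, hk⟩ := (Module.End.mem_maxGenEigenspace _ _ _).1 hv
    have h1 := apply_pow_sub_smul_eq (Matrix.toLin' g) φ hφg β k v
    rw [hk, map_zero] at h1
    rw [LinearMap.mem_ker]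
    exact (mul_eq_zero.1 h1.symm).resolve_left (pow_ne_zero k (sub_ne_zero.2 (Ne.symm hβne)))
  have hβt : βt = g' i₀ i₀ := by
    by_contra hne
    have hall : ∀ β, maxGenEigenspace (Matrix.toLin' g) β ≤ LinearMap.range (Matrix.toLin' Λm) := by
      intro β
      by_cases hb : β = βt
      · subst hb; exact hE _ hne
      · exact hβ β hb
    have htop : (⊤ : Submodule ℂ (Fin (n' + 1) → ℂ)) ≤ LinearMap.range (Matrix.toLin' Λm) := by
      rw [← Module.End.iSup_maxGenEigenspace_eq_top (Matrix.toLin' g)]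
      exact iSup_le hall
    have hv₁ : φ (V₀⁻¹ *ᵥ Pi.single i₀ 1) = 0 := by
      have := hrange_le (htop (Submodule.mem_top (x := V₀⁻¹ *ᵥ Pi.single i₀ 1)))
      rwa [LinearMap.mem_ker] at this
    rw [hφ, Matrix.mulVec_mulVec, hVinv', Matrix.one_mulVec] at hv₁
    simp at hv₁
  ------------------------------------------------------------------
  -- Step 3: combine with the normal-form identity
  ------------------------------------------------------------------
  calc g.det * γ₀ = g'.det * h' i₀ i₀ := by rw [hdg, hγ₀]
    _ = h'.det * g' i₀ i₀ := hdet'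
    _ = h.det * βt := by rw [hdh, hβt]

end Character

/-! ### The character of `perm_m` on the torus, and the determinant of a lift -/

section Perm

variable {m : ℕ}

/-- **The torus rescales the permanent by its character**: substituting `x_{kj} ↦ d_k e_j x_{kj}`
(the element `diag(d) ⊗ diag(e)` of `T(E) × T(F)`, LR17 §2.1) multiplies `perm_m` by `∏ d · ∏ e`
(LR17 §1: `χ_{perm_m}`). [cite: LandsbergRessayre2017, §2.1] -/
theorem linSubst_diagonal_perPoly (d e : Fin m → ℂ) :
    linSubst (Fin m × Fin m) ℂ (Matrix.diagonal d ⊗ₖ Matrix.diagonal e) (perPoly (Fin m) ℂ) =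
      C ((∏ k, d k) * ∏ j, e j) * perPoly (Fin m) ℂ := by
  classical
  have hX : ∀ v : Fin m × Fin m, linSubst (Fin m × Fin m) ℂ (Matrix.diagonal d ⊗ₖ Matrix.diagonal e) (X v) =
      (d v.1 * e v.2) • X v := by
    intro v
    rw [linSubst_X, Matrix.diagonal_kronecker_diagonal, Finset.sum_eq_single v]
    · rw [Matrix.diagonal_apply_eq]
    · intro w _ hw
      rw [Matrix.diagonal_apply_ne _ hw, zero_smul]
    · intro hv; exact absurd (Finset.mem_univ v) hv
  unfold perPoly Matrix.permanent
  rw [map_sum, Finset.mul_sum]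
  refine Finset.sum_congr rfl fun σ _ => ?_
  rw [map_prod]
  have h1 : ∀ i, linSubst (Fin m × Fin m) ℂ (Matrix.diagonal d ⊗ₖ Matrix.diagonal e)
      (Matrix.mvPolynomialX (Fin m) (Fin m) ℂ (σ i) i) = C (d (σ i) * e i) * X (σ i, i) := by
    intro i
    rw [Matrix.mvPolynomialX_apply, hX, smul_eq_C_mul]
  simp_rw [h1]
  rw [Finset.prod_mul_distrib, ← map_prod]
  have hd : (∏ i, d (σ i) * e i) = (∏ k, d k) * ∏ j, e j := by
    rw [Finset.prod_mul_distrib, Equiv.Perm.prod_comp σ Finset.univ d (by simp)]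
  rw [hd]
  rfl

/-- **The determinant of a lift** (LR17 Lemma 3.1, `χ_{det_n}(g) = χ_P(ρ̄_A(g))`, for ONE exact
lift): if `Ã(γ·x) = g Ã(x) h⁻¹` then `γ · det Ã = (det g · det h⁻¹) · det Ã`.  (The tree's
`IsEquivariantDetRepr.linSubst_eq_smul` re-chooses the lift; here `g, h` are the given ones.)
[cite: LandsbergRessayre2017, Lemma 3.1] -/
theorem linSubst_det_eq_of_linSubstEntries_eq {σ : Type*} [Fintype σ] [DecidableEq σ] {n : ℕ}
    {A : Matrix (Fin n) (Fin n) (MvPolynomial σ ℂ)} {γ : GL σ ℂ} {g h : GL (Fin n) ℂ}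
    (hgh : Matrix.linSubstEntries γ A =
      (g : Matrix (Fin n) (Fin n) ℂ).map C * A * ((h⁻¹ : GL (Fin n) ℂ) : Matrix (Fin n) (Fin n) ℂ).map C) :
    linSubst σ ℂ (γ : Matrix σ σ ℂ) A.det =
      C ((g : Matrix (Fin n) (Fin n) ℂ).det * ((h⁻¹ : GL (Fin n) ℂ) : Matrix (Fin n) (Fin n) ℂ).det) * A.det := by
  have hdet := congrArg Matrix.det hgh
  rw [Matrix.det_mul, Matrix.det_mul] at hdet
  have hA : (Matrix.linSubstEntries γ A).det = linSubst σ ℂ (γ : Matrix σ σ ℂ) A.det := by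
    simp only [Matrix.linSubstEntries]
    exact (AlgHom.map_det (linSubst σ ℂ (γ : Matrix σ σ ℂ)) A).symm
  rw [hA] at hdet
  rw [hdet, map_mul, RingHom.map_det, RingHom.map_det, RingHom.mapMatrix_apply, RingHom.mapMatrix_apply]
  ring

/-- Hence, for an exact lift `(g, h)` of the torus element `diag(d) ⊗ diag(e)` of an affine
determinantal representation of `perm_m`: `det g · det h⁻¹ = ∏ d · ∏ e` (compare the two
expressions for `(diag(d) ⊗ diag(e)) · perm_m` and cancel `perm_m ≠ 0`). [cite: LandsbergRessayre2017, Lemma 3.1] -/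
theorem det_mul_det_inv_eq_character {n : ℕ} {A : Matrix (Fin n) (Fin n) (MvPolynomial (Fin m × Fin m) ℂ)}
    (hdetA : A.det = perPoly (Fin m) ℂ) {γ : GL (Fin m × Fin m) ℂ} {d e : Fin m → ℂ}
    (hγ : (γ : Matrix (Fin m × Fin m) (Fin m × Fin m) ℂ) = Matrix.diagonal d ⊗ₖ Matrix.diagonal e)
    {g h : GL (Fin n) ℂ}
    (hgh : Matrix.linSubstEntries γ A =
      (g : Matrix (Fin n) (Fin n) ℂ).map C * A * ((h⁻¹ : GL (Fin n) ℂ) : Matrix (Fin n) (Fin n) ℂ).map C) :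
    (g : Matrix (Fin n) (Fin n) ℂ).det * ((h⁻¹ : GL (Fin n) ℂ) : Matrix (Fin n) (Fin n) ℂ).det =
      (∏ k, d k) * ∏ j, e j := by
  classical
  have h1 := linSubst_det_eq_of_linSubstEntries_eq hgh
  rw [hdetA, hγ, linSubst_diagonal_perPoly] at h1
  have hper : perPoly (Fin m) ℂ ≠ 0 := by
    intro h0
    have := congrArg (MvPolynomial.eval fun _ => (1 : ℂ)) h0
    rw [eval_perPoly, map_zero] at this
    have h1' : (Matrix.of fun i j : Fin m => (fun _ : Fin m × Fin m => (1 : ℂ)) (i, j)) =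
        Matrix.of (fun _ _ => (1 : ℂ)) := rfl
    rw [h1'] at this
    rw [Matrix.permanent] at this
    simp only [Matrix.of_apply, Finset.prod_const_one, Finset.sum_const, Finset.card_univ,
      nsmul_eq_mul, mul_one] at this
    exact Nat.cast_ne_zero.2 (Fintype.card_ne_zero (α := Equiv.Perm (Fin m))) this
  have h2 := mul_right_cancel₀ hper h1
  exact (C_injective _ _ h2).symm

end Perm

/-! ### The top weight of a torus lift of `perm_m` -/

section Top

variable {m n : ℕ}

/-- **The top weight is the character** (LR17 §6, the character of `ℓ_2`; Lemma 3.1 + Lemma 3.3):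
let `A` be an affine determinantal representation of `perm_m` with regular constant part
`Λ = Ã(0)` (`rank Λ = n - 1`), and `(g, h)` an exact lift of the torus element
`γ = diag(d) ⊗ diag(e)`: `Ã(γ·x) = g Ã(x) h⁻¹`.  If `h` has the weight `γ₀` on `ker Λ` and `β_top`
is the weight of `g` on `ℂⁿ / range Λ`, then `β_top = (∏ d · ∏ e) · γ₀`. [cite: LandsbergRessayre2017, §6] -/
theorem top_eq_character_mul (hn : 0 < n) {A : Matrix (Fin n) (Fin n) (MvPolynomial (Fin m × Fin m) ℂ)}
    (hdetA : A.det = perPoly (Fin m) ℂ) (hrank : (constPart A).rank = n - 1)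
    {γ : GL (Fin m × Fin m) ℂ} {d e : Fin m → ℂ}
    (hγ : (γ : Matrix (Fin m × Fin m) (Fin m × Fin m) ℂ) = Matrix.diagonal d ⊗ₖ Matrix.diagonal e)
    {g h : GL (Fin n) ℂ}
    (hgh : Matrix.linSubstEntries γ A =
      (g : Matrix (Fin n) (Fin n) ℂ).map C * A * ((h⁻¹ : GL (Fin n) ℂ) : Matrix (Fin n) (Fin n) ℂ).map C)
    {γ₀ βt : ℂ}
    (hγ₀ : LinearMap.ker (Matrix.toLin' (constPart A)) ≤
      maxGenEigenspace (Matrix.toLin' (h : Matrix (Fin n) (Fin n) ℂ)) γ₀)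
    (hβ : ∀ β, β ≠ βt → maxGenEigenspace (Matrix.toLin' (g : Matrix (Fin n) (Fin n) ℂ)) β ≤
      LinearMap.range (Matrix.toLin' (constPart A))) :
    βt = ((∏ k, d k) * ∏ j, e j) * γ₀ := by
  have e1 : (g : Matrix (Fin n) (Fin n) ℂ) * constPart A = constPart A * (h : Matrix (Fin n) (Fin n) ℂ) :=
    mul_constPart_eq_of_linSubstEntries_eq hgh
  have hchar := det_mul_det_inv_eq_character hdetA hγ hgh
  have hid := det_mul_eq_det_mul_top hn hrank e1 hγ₀ hβ
  -- `det h ≠ 0` and `det h⁻¹ = (det h)⁻¹`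
  have hhdet : (h : Matrix (Fin n) (Fin n) ℂ).det * ((h⁻¹ : GL (Fin n) ℂ) : Matrix (Fin n) (Fin n) ℂ).det = 1 := by
    rw [← Matrix.det_mul, ← Units.val_mul, mul_inv_cancel, Units.val_one, Matrix.det_one]
  have hh0 : (h : Matrix (Fin n) (Fin n) ℂ).det ≠ 0 := left_ne_zero_of_mul_eq_one hhdet
  -- `det g = χ det h`
  have hg : (g : Matrix (Fin n) (Fin n) ℂ).det = ((∏ k, d k) * ∏ j, e j) * (h : Matrix (Fin n) (Fin n) ℂ).det := by
    calc (g : Matrix (Fin n) (Fin n) ℂ).det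
        = (g : Matrix (Fin n) (Fin n) ℂ).det * ((h : Matrix (Fin n) (Fin n) ℂ).det *
            ((h⁻¹ : GL (Fin n) ℂ) : Matrix (Fin n) (Fin n) ℂ).det) := by rw [hhdet, mul_one]
      _ = ((g : Matrix (Fin n) (Fin n) ℂ).det * ((h⁻¹ : GL (Fin n) ℂ) : Matrix (Fin n) (Fin n) ℂ).det) *
            (h : Matrix (Fin n) (Fin n) ℂ).det := by ring
      _ = ((∏ k, d k) * ∏ j, e j) * (h : Matrix (Fin n) (Fin n) ℂ).det := by rw [hchar]
  rw [hg] at hid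
  -- cancel `det h`
  have : (h : Matrix (Fin n) (Fin n) ℂ).det * (((∏ k, d k) * ∏ j, e j) * γ₀) =
      (h : Matrix (Fin n) (Fin n) ℂ).det * βt := by rw [← hid]; ring
  exact (mul_left_cancel₀ hh0 this).symm

end Top


/-! ### The top weight exists; for a torus lift of `perm_m` it is the character (appended) -/

section TopExists

/-- **The top weight exists** (LR17 §6: the lifted symmetry acts on the line `ℓ_2 = ℂⁿ / range Λ`
by a scalar; abstract form of `TorusData.exists_top`, for any endomorphism `B` preserving
`range Λ` and `dim ker Λ = 1`): there is `β_top` such that every weight space `E β` of `B` with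
`β ≠ β_top` lies in `range Λ`. [cite: LandsbergRessayre2017, §6] -/
theorem exists_top_of_map_range_le {V : Type*} [AddCommGroup V] [Module ℂ V] [FiniteDimensional ℂ V]
    (Λ B : Module.End ℂ V) (hB : (LinearMap.range Λ).map B ≤ LinearMap.range Λ)
    (hK : Module.finrank ℂ (LinearMap.ker Λ) = 1) :
    ∃ βt : ℂ, ∀ β, β ≠ βt → maxGenEigenspace B β ≤ LinearMap.range Λ := by
  set H := LinearMap.range Λ with hHdef
  have hdim : Module.finrank ℂ H + 1 = Module.finrank ℂ V := by
    have := LinearMap.finrank_range_add_finrank_ker Λ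
    rw [hK] at this; exact this
  have hHtop : H ≠ ⊤ := by
    intro h; rw [h, finrank_top] at hdim; omega
  obtain ⟨v₁, -, hv₁⟩ := SetLike.exists_of_lt (lt_top_iff_ne_top.2 hHtop)
  have hsup : H ⊔ (ℂ ∙ v₁) = ⊤ := by
    apply Submodule.eq_top_of_finrank_eq
    apply le_antisymm (Submodule.finrank_le _)
    have hlt : H < H ⊔ (ℂ ∙ v₁) := by
      refine lt_of_le_of_ne le_sup_left fun h => hv₁ ?_
      rw [h]; exact Submodule.mem_sup_right (Submodule.mem_span_singleton_self v₁)
    have := Submodule.finrank_lt_finrank_of_lt hlt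
    omega
  have hdec : ∀ v : V, ∃ h ∈ H, ∃ a : ℂ, v = h + a • v₁ := fun v => by
    have hv : v ∈ H ⊔ (ℂ ∙ v₁) := by rw [hsup]; exact Submodule.mem_top
    obtain ⟨h, hh, z, hz, rfl⟩ := Submodule.mem_sup.1 hv
    obtain ⟨a, rfl⟩ := Submodule.mem_span_singleton.1 hz
    exact ⟨h, hh, a, rfl⟩
  obtain ⟨h₁, hh₁, βt, hB₁⟩ := hdec (B v₁)
  refine ⟨βt, fun β hβ => ?_⟩
  have hall : ∀ v, B v - βt • v ∈ H := fun v => by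
    obtain ⟨h, hh, a, rfl⟩ := hdec v
    have : B (h + a • v₁) - βt • (h + a • v₁) = (B h - βt • h) + a • h₁ := by
      rw [map_add, map_smul, hB₁, smul_add, smul_add, smul_smul, smul_smul, mul_comm a βt]
      abel
    rw [this]
    exact H.add_mem (H.sub_mem (hB (Submodule.mem_map_of_mem hh)) (H.smul_mem _ hh))
      (H.smul_mem _ hh₁)
  -- `(B - β)^N ≡ (βt - β)^N` modulo `H`
  have hpow : ∀ (N : ℕ) (v : V), ((B - β • (1 : Module.End ℂ V)) ^ N) v - (βt - β) ^ N • v ∈ H := by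
    intro N
    induction N with
    | zero => intro v; simp
    | succ N ih =>
      intro v
      rw [pow_succ', Module.End.mul_apply, pow_succ', mul_smul]
      set w := ((B - β • (1 : Module.End ℂ V)) ^ N) v
      have : (B - β • (1 : Module.End ℂ V)) w - (βt - β) • ((βt - β) ^ N • v) =
          (B w - βt • w) + (βt - β) • (w - (βt - β) ^ N • v) := by
        simp only [LinearMap.sub_apply, LinearMap.smul_apply, Module.End.one_apply, smul_sub, sub_smul,
          smul_smul]
        abel
      rw [this]
      exact H.add_mem (hall w) (H.smul_mem _ (ih v))
  intro v hv
  obtain ⟨N, hN⟩ := (Module.End.mem_maxGenEigenspace _ _ _).1 hv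
  have key := hpow N v
  rw [hN, zero_sub, neg_mem_iff] at key
  exact (Submodule.smul_mem_iff H (pow_ne_zero N (sub_ne_zero.2 (Ne.symm hβ)))).1 key

variable {m n : ℕ}

/-- `g Λ = Λ h` makes `range Λ` stable under `g`. [folklore] -/
theorem map_range_toLin'_le {Λm g h : Matrix (Fin n) (Fin n) ℂ} (e : g * Λm = Λm * h) :
    (LinearMap.range (Matrix.toLin' Λm)).map (Matrix.toLin' g) ≤ LinearMap.range (Matrix.toLin' Λm) := by
  rintro _ ⟨_, ⟨w, rfl⟩, rfl⟩
  refine ⟨Matrix.toLin' h w, ?_⟩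
  rw [← Matrix.toLin'_mul_apply, ← e, Matrix.toLin'_mul_apply]

/-- A constant part of rank `n - 1` has a kernel LINE. [folklore] -/
theorem finrank_ker_toLin'_eq_one {Λm : Matrix (Fin n) (Fin n) ℂ} (hn : 0 < n) (hrank : Λm.rank = n - 1) :
    Module.finrank ℂ (LinearMap.ker (Matrix.toLin' Λm)) = 1 := by
  have h1 := LinearMap.finrank_range_add_finrank_ker (Matrix.toLin' Λm)
  rw [Module.finrank_fin_fun] at h1
  have h2 : Module.finrank ℂ (LinearMap.range (Matrix.toLin' Λm)) = n - 1 := by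
    rw [Matrix.toLin'_apply']; exact hrank
  omega

/-- **The top weight of a torus lift of `perm_m` is the character, unconditionally**: with the
data of `top_eq_character_mul` (affine determinantal representation `A` of `perm_m` with regular
constant part, exact lift `(g, h)` of `diag(d) ⊗ diag(e)`, kernel weight `γ₀` of `h`), EVERY weight
space `E β` of `g` with `β ≠ (∏ d · ∏ e) · γ₀` lies in `range Λ` — i.e. the top weight is
`(∏ d ∏ e) γ₀` and its exponent is `(1, …, 1; 1, …, 1)` (LR17 §6, character of `ℓ_2`).
[cite: LandsbergRessayre2017, §6] -/
theorem maxGenEigenspace_le_range_of_ne_character (hn : 0 < n)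
    {A : Matrix (Fin n) (Fin n) (MvPolynomial (Fin m × Fin m) ℂ)}
    (hdetA : A.det = perPoly (Fin m) ℂ) (hrank : (constPart A).rank = n - 1)
    {γ : GL (Fin m × Fin m) ℂ} {d e : Fin m → ℂ}
    (hγ : (γ : Matrix (Fin m × Fin m) (Fin m × Fin m) ℂ) = Matrix.diagonal d ⊗ₖ Matrix.diagonal e)
    {g h : GL (Fin n) ℂ}
    (hgh : Matrix.linSubstEntries γ A =
      (g : Matrix (Fin n) (Fin n) ℂ).map C * A * ((h⁻¹ : GL (Fin n) ℂ) : Matrix (Fin n) (Fin n) ℂ).map C)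
    {γ₀ : ℂ}
    (hγ₀ : LinearMap.ker (Matrix.toLin' (constPart A)) ≤
      maxGenEigenspace (Matrix.toLin' (h : Matrix (Fin n) (Fin n) ℂ)) γ₀) :
    ∀ β, β ≠ ((∏ k, d k) * ∏ j, e j) * γ₀ →
      maxGenEigenspace (Matrix.toLin' (g : Matrix (Fin n) (Fin n) ℂ)) β ≤
        LinearMap.range (Matrix.toLin' (constPart A)) := by
  have e1 : (g : Matrix (Fin n) (Fin n) ℂ) * constPart A = constPart A * (h : Matrix (Fin n) (Fin n) ℂ) :=
    mul_constPart_eq_of_linSubstEntries_eq hgh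
  obtain ⟨βt, hβt⟩ := exists_top_of_map_range_le (Matrix.toLin' (constPart A))
    (Matrix.toLin' (g : Matrix (Fin n) (Fin n) ℂ)) (map_range_toLin'_le e1)
    (finrank_ker_toLin'_eq_one hn hrank)
  have := top_eq_character_mul hn hdetA hrank hγ hgh hγ₀ hβt
  rw [← this]
  exact hβt

end TopExists

end LRPencil

end Literature.Computability.AlgebraicComplexity
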